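import Summits.Ventures.CertifiedManyBodySolver.Observables.PinningFieldResponseBracketDWave
import Summits.Ventures.CertifiedManyBodySolver.Certificates.HubbardSquare_n7o8_upper_dbt299pair_row354
import HarnessLib
import HarnessLib.Audit

/-!
# Ventures/CertifiedManyBodySolver — Certificates/HubbardSquare_n7o8_pinning_tp0_HFbracket_r354.lean

HONEST FRAMING: MENU NODES for the pinning-field response at the anchor A0′ = (U, n, t′) = (8, 7/8, 0); zero compute;
CONDITIONAL on the claim node #354 BY NAME and on a pair-SOURCED lower-bound certificate that DOES NOT EXIST today
(hypothesis of the stated shape — pub-hubbard 2026-08-20: «No pair-sourced window certificate exists»; cell `hubbard-cq`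
pilots `hubbard-cq-pilot-1/2` are to produce it at `h ∈ {0.05, 0.1, 0.2}`); a bracket on the SOURCED pair amplitude
at `h > 0` is not a statement about order of the source-free model; positivity scale until fed; not informative vs
print; not a superconductivity verdict; no phase sentence.

Cell `hubbard-obs` (D-0042 / D-0082 (c-2)), seat `hubbard-obs-pin-2` (`prover-hubbard-obs-pin-2-g0-0`). Anchor leaves of
`Observables/PinningFieldResponseBracket[DWave].lean` (the Hellmann–Feynman bracket nodes): the grand-canonical
`d`-wave sourced torus `A_L(h) = dWaveSourceTorus L 8 μ h = H_L(1,8) − μN_L − h(Δ_d + Δ_dᴴ)` (any `μ`), its torus-limit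
ground states `ω` (limits of translation averages of unit ground-state vectors, `Ls → ∞`), the local `d`-wave pair `P₀`.

* `u8_n7o8_tp0_sourcedPair_le_of_r354_of_sourcedLower` — **UPPER edge fed today modulo ONE sourced certificate**:
  #354 (`e(1,0,8,7/8) ≤ hi₃₅₄ = −99352233445291/2⁴⁷ ≈ −0.7059400776`) + a sourced lower certificate
  `∃ L₀, ∀ L ≥ L₀, ℓ·L² ≤ E₀(A_L(h₂))` at `h₂ > h` ⇒ `Re ω(P₀) ≤ (hi₃₅₄ − μ·(7/8) − ℓ)/(2(h₂ − h))` for every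
  torus-limit ground state of `A_·(h)` (the every-ground-state companion of obs-p1's order-parameter ceiling; `μ` free).
* `u8_n7o8_tp0_dWaveOrderParameter_le_of_r354_of_sourcedLower` — the same number caps the Koma–Tasaki order
  parameter `dWaveOrderParameter 8 μ` (`0 < h < h₂`; obs-p1's F-B′ re-keyed to the certificate shape of record).
* `u8_sourcedPair_floor_of_sourcedCap_of_sourcedLower` — **the FLOOR reading** (the CQ-PRESENT-relevant edge): a
  SOURCED cap `E₀(A_L(h)) ≤ u·L²` and a cut `ℓ·L² ≤ E₀(A_L(h₁))`, `h₁ < h` ⇒ `(ℓ − u)/(2(h − h₁)) ≤ Re ω(P₀)`;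
  by `Observables.floor_nonpos_of_sourceFree_cap` this is vacuous unless `u` beats the certified source-free lower
  edge — with #473 (`lo₄₇₃ ≈ −0.8372323`) that means a pinned variational state at field `h` certified below
  `lo₄₇₃ − μ·(7/8)`-class grand-canonical floors (gain scale `2·h·Re ω(P₀)` per site [planning]).
* `u8_n7o8_tp0_HFbracket_literals` — decidable arithmetic of the reading rule (the value of `hi₃₅₄`, and the
  bracket width as a function of the slacks at the pilot grid `h ∈ {1/20, 1/10, 1/5}`: e.g. cap–cut slack `s` at
  `(h, h₂) = (1/10, 1/5)` reads `Re ω(P₀) ≤ 5·s`).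

References: T. Koma, H. Tasaki, J. Stat. Phys. 76 (1994) 745, §1 [KomaTasaki1994]; R. B. Griffiths, Phys. Rev. 152
(1966) 240, §II [Griffiths1966]; D. J. Scalapino, S. R. White, S.-C. Zhang, PRB 47 (1993) 7995, §II [ScalapinoWhiteZhang1993].
-/

noncomputable section

namespace Summit.Ventures.CertifiedManyBodySolver.Certificates

open Literature.MathematicalPhysics.QuantumLattice
open Literature.MathematicalPhysics.QuantumLattice.ThermodynamicLimit
open Literature.Probability.LatticeModels
open Summit.Ventures.CertifiedManyBodySolver.Observables
open Filter Topology HubbardWave0 Finset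
open scoped Matrix BigOperators ComplexOrder

/-! ## §1 The UPPER edge at A0′ modulo one sourced certificate -/

/-- **A0′ sourced pair-amplitude CEILING from #354 and ONE sourced lower certificate** (conditional on #354 BY NAME;
the sourced certificate is a HYPOTHESIS of the shape of record): for every `μ`, sources `h < h₂`, and every torus-limit
ground state `ω` of `dWaveSourceTorus · 8 μ h`, `Re ω(P₀) ≤ (hi₃₅₄ − μ·(7/8) − ℓ)/(2(h₂ − h))`.
[cite: KomaTasaki1994, §1] [cite: Griffiths1966, §II] -/
theorem u8_n7o8_tp0_sourcedPair_le_of_r354_of_sourcedLower (h354 : cert_dbt299pair_allk) (μ : ℝ) {h h₂ ℓ : ℝ}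
    (hlt : h < h₂)
    (hcut : ∃ L₀ : ℕ, ∀ (L : ℕ) [NeZero L], L₀ ≤ L → ℓ * (L : ℝ) ^ 2 ≤ (dWaveSourceTorus L 8 μ h₂).groundEnergy) :
    ∀ (ω : InfVolFermionState 2) (Ls : ℕ → ℕ) (ψ : ∀ L, Fock (Orb (FermionTorus 2 L))),
      Tendsto Ls atTop atTop →
      (∀ (j : ℕ) [NeZero (Ls j)], dWaveSourceTorus (Ls j) 8 μ h *ᵥ ψ (Ls j) =
        (((dWaveSourceTorus (Ls j) 8 μ h).groundEnergy : ℝ) : ℂ) • ψ (Ls j)) →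
      (∀ j, star (ψ (Ls j)) ⬝ᵥ ψ (Ls j) = 1) → ω.IsTorusLimitOf ψ Ls →
      (ω.expect (pairRegion (insert (0 : Site 2) unitSteps) 0)
          (localPairAt (insert (0 : Site 2) unitSteps) dWaveFormFactor 0)).re ≤
        ((((-99352233445291 / 140737488355328 : ℚ)) : ℝ) - μ * (7 / 8) - ℓ) / (2 * (h₂ - h)) := by
  intro ω Ls ψ hLs hgs h1 hω
  have hhi : energyDensityTT' 1 0 8 (7 / 8) ≤ (((-99352233445291 / 140737488355328 : ℚ)) : ℝ) :=
    m3_tp0_upper_dbt299pair_allk_of h354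
  exact re_expect_localPairAt_le_of_canonical_upper_of_sourced_lower (U := 8) (by norm_num) μ (n := 7 / 8)
    (by norm_num) (by norm_num) hhi hω hLs hgs h1 hlt hcut

/-- Reindexing: an `∃ L₀, ∀ L ≥ L₀` bound gives the `∀ᶠ L, … (L+1) …` shape of obs-p1's F-B′ theorems. [folklore] -/
private theorem eventually_succ_of_exists' {P : ∀ (L : ℕ) [NeZero L], Prop}
    (hP : ∃ L₀ : ℕ, ∀ (L : ℕ) [NeZero L], L₀ ≤ L → P L) : ∀ᶠ L : ℕ in atTop, P (L + 1) := by
  obtain ⟨L₀, hL₀⟩ := hP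
  filter_upwards [eventually_ge_atTop L₀] with L hL using hL₀ (L + 1) (by omega)

/-- **A0′ Koma–Tasaki order-parameter CEILING from #354 and ONE sourced lower certificate** (`0 < h < h₂`; obs-p1's
`dWaveOrderParameter_le_of_canonical_upper_of_sourced_lower` with the certificate in the shape of record):
`dWaveOrderParameter 8 μ ≤ (hi₃₅₄ − μ·(7/8) − ℓ)/(2(h₂ − h))`. [cite: KomaTasaki1994, §1] -/
theorem u8_n7o8_tp0_dWaveOrderParameter_le_of_r354_of_sourcedLower (h354 : cert_dbt299pair_allk) (μ : ℝ)
    {h h₂ ℓ : ℝ} (hh : 0 < h) (hlt : h < h₂)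
    (hcut : ∃ L₀ : ℕ, ∀ (L : ℕ) [NeZero L], L₀ ≤ L → ℓ * (L : ℝ) ^ 2 ≤ (dWaveSourceTorus L 8 μ h₂).groundEnergy) :
    dWaveOrderParameter 8 μ ≤ ((((-99352233445291 / 140737488355328 : ℚ)) : ℝ) - μ * (7 / 8) - ℓ) / (2 * (h₂ - h)) :=
  dWaveOrderParameter_le_of_canonical_upper_of_sourced_lower (U := 8) (by norm_num) μ (n := 7 / 8) (by norm_num)
    (by norm_num) (m3_tp0_upper_dbt299pair_allk_of h354) hh hlt
    (eventually_succ_of_exists' (P := fun L _ => ℓ * (L : ℝ) ^ 2 ≤ (dWaveSourceTorus L 8 μ h₂).groundEnergy) hcut)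

/-! ## §2 The FLOOR reading at U = 8 (both inputs sourced; shape only) -/

/-- **The FLOOR reading at `U = 8`** (shape only — no anchor input exists today): a SOURCED cap `E₀(A_L(h)) ≤ u·L²`
and a cut `ℓ·L² ≤ E₀(A_L(h₁))` at `h₁ < h`, both for all large `L`, give `(ℓ − u)/(2(h − h₁)) ≤ Re ω(P₀)` for every
torus-limit ground state of `dWaveSourceTorus · 8 μ h`. Vacuous for a cap inherited from `h = 0`
(`Observables.floor_nonpos_of_sourceFree_cap`). [cite: KomaTasaki1994, §1] [cite: Griffiths1966, §II] -/
theorem u8_sourcedPair_floor_of_sourcedCap_of_sourcedLower (μ : ℝ) {h₁ h u ℓ : ℝ} (hlt : h₁ < h)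
    (hcap : ∃ L₀ : ℕ, ∀ (L : ℕ) [NeZero L], L₀ ≤ L → (dWaveSourceTorus L 8 μ h).groundEnergy ≤ u * (L : ℝ) ^ 2)
    (hcut : ∃ L₀ : ℕ, ∀ (L : ℕ) [NeZero L], L₀ ≤ L → ℓ * (L : ℝ) ^ 2 ≤ (dWaveSourceTorus L 8 μ h₁).groundEnergy) :
    ∀ (ω : InfVolFermionState 2) (Ls : ℕ → ℕ) (ψ : ∀ L, Fock (Orb (FermionTorus 2 L))),
      Tendsto Ls atTop atTop →
      (∀ (j : ℕ) [NeZero (Ls j)], dWaveSourceTorus (Ls j) 8 μ h *ᵥ ψ (Ls j) =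
        (((dWaveSourceTorus (Ls j) 8 μ h).groundEnergy : ℝ) : ℂ) • ψ (Ls j)) →
      (∀ j, star (ψ (Ls j)) ⬝ᵥ ψ (Ls j) = 1) → ω.IsTorusLimitOf ψ Ls →
      (ℓ - u) / (2 * (h - h₁)) ≤ (ω.expect (pairRegion (insert (0 : Site 2) unitSteps) 0)
          (localPairAt (insert (0 : Site 2) unitSteps) dWaveFormFactor 0)).re :=
  fun _ω _Ls _ψ hLs hgs h1 hω => le_re_expect_localPairAt_of_dWaveSource_groundStates hω hLs hgs h1 hlt hcap hcut

/-- **The two-sided reading at `U = 8`** (shape only): cuts at `h₁ < h < h₂` and a cap at `h` bracket `Re ω(P₀)`.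
[cite: KomaTasaki1994, §1] -/
theorem u8_sourcedPair_mem_Icc_of_sourcedCap_of_sourcedLowers (μ : ℝ) {h₁ h h₂ u ℓ₁ ℓ₂ : ℝ} (hlo : h₁ < h)
    (hhi : h < h₂)
    (hcap : ∃ L₀ : ℕ, ∀ (L : ℕ) [NeZero L], L₀ ≤ L → (dWaveSourceTorus L 8 μ h).groundEnergy ≤ u * (L : ℝ) ^ 2)
    (hcut₁ : ∃ L₀ : ℕ, ∀ (L : ℕ) [NeZero L], L₀ ≤ L → ℓ₁ * (L : ℝ) ^ 2 ≤ (dWaveSourceTorus L 8 μ h₁).groundEnergy)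
    (hcut₂ : ∃ L₀ : ℕ, ∀ (L : ℕ) [NeZero L], L₀ ≤ L → ℓ₂ * (L : ℝ) ^ 2 ≤ (dWaveSourceTorus L 8 μ h₂).groundEnergy) :
    ∀ (ω : InfVolFermionState 2) (Ls : ℕ → ℕ) (ψ : ∀ L, Fock (Orb (FermionTorus 2 L))),
      Tendsto Ls atTop atTop →
      (∀ (j : ℕ) [NeZero (Ls j)], dWaveSourceTorus (Ls j) 8 μ h *ᵥ ψ (Ls j) =
        (((dWaveSourceTorus (Ls j) 8 μ h).groundEnergy : ℝ) : ℂ) • ψ (Ls j)) →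
      (∀ j, star (ψ (Ls j)) ⬝ᵥ ψ (Ls j) = 1) → ω.IsTorusLimitOf ψ Ls →
      (ω.expect (pairRegion (insert (0 : Site 2) unitSteps) 0)
          (localPairAt (insert (0 : Site 2) unitSteps) dWaveFormFactor 0)).re ∈
        Set.Icc ((ℓ₁ - u) / (2 * (h - h₁))) ((u - ℓ₂) / (2 * (h₂ - h))) :=
  fun _ω _Ls _ψ hLs hgs h1 hω =>
    re_expect_localPairAt_mem_Icc_of_dWaveSource_groundStates hω hLs hgs h1 hlo hhi hcap hcut₁ hcut₂

/-! ## §3 Literals of the reading rule -/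

/-- Decidable arithmetic of the A0′ reading rule: `hi₃₅₄ = −99352233445291/2⁴⁷ ∈ (−0.70594008, −0.70594007)`; the
bracket multipliers `1/(2(h₂ − h))` on the pilot grid `h ∈ {1/20, 1/10, 1/5}`: `(1/20, 1/10) ↦ 10`, `(1/10, 1/5) ↦ 5`,
`(1/20, 1/5) ↦ 10/3`, `(0, 1/20) ↦ 10` (a cap–cut slack `s` per site reads as `Re ω(P₀) ≤ multiplier · s`; e.g. today's
source-free window width `lo₄₇₃…hi₃₅₄ = 0.1312922724·t`-class slack at `(1/10, 1/5)` would read `≤ 0.66`-class, the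
positivity scale — informative needs sourced slacks `≲ 10⁻²·t`). [cite: KomaTasaki1994, §1] -/
theorem u8_n7o8_tp0_HFbracket_literals :
    (140737488355328 : ℚ) = 2 ^ 47 ∧
    (-0.70594008 : ℚ) < -99352233445291 / 140737488355328 ∧ (-99352233445291 / 140737488355328 : ℚ) < -0.70594007 ∧
    (1 : ℚ) / (2 * (1 / 10 - 1 / 20)) = 10 ∧ (1 : ℚ) / (2 * (1 / 5 - 1 / 10)) = 5 ∧
    (1 : ℚ) / (2 * (1 / 5 - 1 / 20)) = 10 / 3 ∧ (1 : ℚ) / (2 * (1 / 20 - 0)) = 10 ∧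
    (-99352233445291 / 140737488355328 : ℚ) - (-1012151804787154021296135 / 1208925819614629174706176) <
      0.1312922725 ∧
    (5 : ℚ) * 0.1312922725 < 0.66 := by
  norm_num

end Summit.Ventures.CertifiedManyBodySolver.Certificates

end
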